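import Summits.KontsevichZagierPeriods.KontsevichZagierPeriods.Theorems.RootDecompQuadraticDescentPair18HomotopyP28

/-! # `RootDecompQuadraticDescentPair18HomotopyP29` — part 29/31 of the mechanical ≤400-line split of `Pair18Homotopy_v14_noguard.lean` (sha256 72e9c8442b4af820…)
Source: decomp-kz lens-6 g9 `Pair18Homotopy.lean` v14 (HOME/decomp-kz-lens-6/g9/, sha256 3dda3232…; critic g4-48/g4-53/g4-56/g5 CLEARED; census pair #18 of crux stmt-KontsevichZagierPeriods-28994: homotopy cells, duplications, inversions, Euler–Landen, arc/angle regions; terminal `pair18_g8strips_of_grid : hEuler → hGrid → hAng4 → (g8 form of #18)`); `#guard_msgs … #print axioms` pins removed for landing.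
Split by census-1 g9 `gen/splitlean.py`: scopes re-opened with their `open`/`variable`/`set_option` context; mathematics and declaration order unchanged. -/

set_option linter.unusedSimpArgs false
noncomputable section
open _root_.Set MvPolynomial
namespace Summit.KontsevichZagierPeriods.RootDecompQuadraticDescent.Pair18Homotopy
open Literature.NumberTheory.Transcendental
open Literature.NumberTheory.Transcendental.KZ (RFun cube)
open Summit.KontsevichZagierPeriods.RootDecompQuadraticDescent.DarkPairs (rel_reflect_rep rel_double)

section Fold
open Literature.ModelTheory.ExponentialFields (IsSemialgebraic isSemialgebraic_setOf_eval_le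
  isSemialgebraic_setOf_eval_pos isSemialgebraic_setOf_eval_nonneg isSemialgebraic_setOf_eval_eq_zero)

open _root_.Set MvPolynomial in
open Literature.NumberTheory.Transcendental in
open Literature.NumberTheory.Transcendental.KZ (RFun cube) in
open Summit.KontsevichZagierPeriods.RootDecompQuadraticDescent.DarkPairs (rel_reflect_rep rel_double) in
/-- Auxiliary step `vec2_1` (§2b): vec2 1. [bookkeeping] -/
private theorem vec2_1 (a b : ℝ) : (![a, b] : Fin 2 → ℝ) 1 = b := rfl

open _root_.Set MvPolynomial in
open Literature.NumberTheory.Transcendental in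
open Literature.NumberTheory.Transcendental.KZ (RFun cube) in
open Summit.KontsevichZagierPeriods.RootDecompQuadraticDescent.DarkPairs (rel_reflect_rep rel_double) in
/-- Auxiliary step `vec2_0` (§2b): vec2 0. [bookkeeping] -/
private theorem vec2_0 (a b : ℝ) : (![a, b] : Fin 2 → ℝ) 0 = a := rfl

open _root_.Set MvPolynomial in
open Literature.NumberTheory.Transcendental in
open Literature.NumberTheory.Transcendental.KZ (RFun cube) in
open Summit.KontsevichZagierPeriods.RootDecompQuadraticDescent.DarkPairs (rel_reflect_rep rel_double) in
/-- Auxiliary step `cube2` (§0): cube2. [bookkeeping] -/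
private theorem cube2 {x : Fin 2 → ℝ} (hx : x ∈ KZ.cube 2) : (0 ≤ x 0 ∧ x 0 ≤ 1) ∧ (0 ≤ x 1 ∧ x 1 ≤ 1) := ⟨hx 0, hx 1⟩

set_option maxHeartbeats 1600000 in
/-- **the decreasing piece**: `[M2log | ∂ₓD ≤ 0] ≡ [FN | I₁]` (`FN = −FT`) by the same map; here
`|det DΦ| = −(16/25)∂ₓD`. -/
theorem fold1_cov : KZ.of M2log1 - KZ.of FN1 ∈ KZ.relations := by
  let Φ : (Fin 2 → ℝ) → (Fin 2 → ℝ) := fun z =>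
    ![(16 * (1 - (1 + 2 * z 1) * z 0 + (2 + 2 * z 1) * z 0 * z 0) - 7) / 25, z 1]
  let M00 : (Fin 2 → ℝ) → ℝ := fun z => 16 / 25 * ((4 + 4 * z 1) * z 0 - (1 + 2 * z 1))
  let M01 : (Fin 2 → ℝ) → ℝ := fun z => 16 / 25 * (2 * z 0 * z 0 - 2 * z 0)
  let Mz : (Fin 2 → ℝ) → Matrix (Fin 2) (Fin 2) ℝ := fun z => !![M00 z, M01 z; 0, 1]
  let Φ' : (Fin 2 → ℝ) → (Fin 2 → ℝ) →L[ℝ] (Fin 2 → ℝ) := fun z =>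
    LinearMap.toContinuousLinearMap (Matrix.toLin' (Mz z))
  have hΦ'ap : ∀ z w, Φ' z w = ![M00 z * w 0 + M01 z * w 1, w 1] := by
    intro z w; funext i
    fin_cases i <;> simp [Φ', Mz, Matrix.toLin'_apply, Matrix.mulVec, dotProduct, Fin.sum_univ_two]
  have hdet : ∀ z, (Φ' z).det = M00 z := by
    intro z
    unfold ContinuousLinearMap.det
    simp [Φ', LinearMap.det_toLin', Mz, Matrix.det_fin_two]
  have hΦ0 : ∀ z, Φ z 0 = (16 * (1 - (1 + 2 * z 1) * z 0 + (2 + 2 * z 1) * z 0 * z 0) - 7) / 25 :=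
    fun z => rfl
  have hΦ1 : ∀ z, Φ z 1 = z 1 := fun z => rfl
  have hdom : FN1.domain = Φ '' M2log1.domain := by
    simp only [FN1, M2log1, KZ.IntegralRep.domain_restrict, RFun.rep_domain, FI1, FP1, sI, sLo, sF1]
    ext w
    constructor
    · rintro ⟨⟨hw, hI⟩, hL⟩
      simp only [mem_setOf_eq] at hI hL
      obtain ⟨hw0, hw1⟩ := cube2 hw
      have h44 : (0:ℝ) < 4 + 4 * w 1 := by linarith
      obtain ⟨a, ha, ha0, ha1, hfa⟩ := vertex_facts (w 1) (w 0) hw1.1 hI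
      obtain ⟨x, hx, hx_eq⟩ : ∃ x ∈ Icc 0 a,
          16 * (1 - (1 + 2 * w 1) * x + (2 + 2 * w 1) * x * x) - 25 * w 0 - 7 = 0 := by
        have hc : ContinuousOn
            (fun x : ℝ => 16 * (1 - (1 + 2 * w 1) * x + (2 + 2 * w 1) * x * x) - 25 * w 0 - 7) (Icc 0 a) := by
          fun_prop
        have hf0 : 0 ≤ 16 * (1 - (1 + 2 * w 1) * 0 + (2 + 2 * w 1) * 0 * 0) - 25 * w 0 - 7 := by linarith
        have hmem : (0:ℝ) ∈ Icc
            ((fun x : ℝ => 16 * (1 - (1 + 2 * w 1) * x + (2 + 2 * w 1) * x * x) - 25 * w 0 - 7) a)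
            ((fun x : ℝ => 16 * (1 - (1 + 2 * w 1) * x + (2 + 2 * w 1) * x * x) - 25 * w 0 - 7) 0) :=
          ⟨hfa, hf0⟩
        exact intermediate_value_Icc' ha0 hc hmem
      refine ⟨![x, w 1], ⟨?_, ?_⟩, ?_⟩
      · intro i
        fin_cases i
        · simpa using (show x ∈ Icc (0:ℝ) 1 from ⟨hx.1, le_trans hx.2 ha1⟩)
        · simpa using hw1
      · simp only [mem_setOf_eq, Matrix.cons_val_zero, Matrix.cons_val_one, Matrix.head_cons]
        linarith [mul_le_mul_of_nonneg_left hx.2 h44.le]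
      · funext i
        fin_cases i
        · have key : (16 * (1 - (1 + 2 * w 1) * x + (2 + 2 * w 1) * x * x) - 7) / 25 = w 0 := by
            rw [div_eq_iff (by norm_num : (25:ℝ) ≠ 0)]; linarith
          simpa [Φ] using key
        · simp [Φ]
    · rintro ⟨z, hz, rfl⟩
      obtain ⟨h0, h1, ht, hDx, hD, hD1, hD7⟩ := FP1_facts z hz
      refine ⟨⟨fun i => ?_, ?_⟩, ?_⟩
      · fin_cases i
        · simp only [Φ, Fin.zero_eta, Matrix.cons_val_zero]
          constructor
          · apply div_nonneg _ (by norm_num); linarith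
          · rw [div_le_one (by norm_num)]; linarith
        · simpa [Φ] using h1
      · simp only [mem_setOf_eq, Φ, Matrix.cons_val_zero, Matrix.cons_val_one, Matrix.head_cons]
        have key : (25 * ((16 * (1 - (1 + 2 * z 1) * z 0 + (2 + 2 * z 1) * z 0 * z 0) - 7) / 25) - 9) *
              (1 + z 1) + 2 * (1 + 2 * z 1) * (1 + 2 * z 1) =
            2 * (((4 + 4 * z 1) * z 0 - (1 + 2 * z 1)) * ((4 + 4 * z 1) * z 0 - (1 + 2 * z 1))) := by ring
        rw [key]
        exact mul_nonneg (by norm_num) (mul_self_nonneg _)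
      · simp only [mem_setOf_eq, Φ, Matrix.cons_val_zero]
        linarith
  refine KZ.changeOfVariablesRel_subset_relations ⟨2, M2log1, FN1, Φ, Φ', ?_, ?_, ?_, hdom, ?_, rfl⟩
  · have hsd : IsSemialgebraic ℚ M2log1.domain := M2log1.isSemialgebraic_domain
    refine (isSemialgebraicMapOn_iff_forall_holds hsd).mpr fun i => ?_
    fin_cases i
    · refine (isSemialgebraicFunOn_aeval_div_aeval hsd (C 16 * M2Den - C 7) (C 25) fun z _ => ?_).congr
        fun z _ => ?_
      · simp only [aeval_C, eq_ratCast, Rat.cast_ofNat]; norm_num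
      · simp only [Φ, Fin.zero_eta, Matrix.cons_val_zero, map_sub, map_mul, aeval_C, aeval_M2Den, eq_ratCast,
          Rat.cast_ofNat]
    · exact (isSemialgebraicFunOn_aeval hsd (X 1)).congr fun z _ => by simp [Φ]
  · intro z _
    have hA := hasFDerivAt_apply (𝕜 := ℝ) 0 z
    have hB := hasFDerivAt_apply (𝕜 := ℝ) 1 z
    have hD := ((((hB.const_mul (2:ℝ)).const_add (1:ℝ)).mul hA).const_sub (1:ℝ)).add
      ((((hB.const_mul (2:ℝ)).const_add (2:ℝ)).mul hA).mul hA)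
    have hu := ((hD.const_mul (16:ℝ)).sub_const (7:ℝ)).mul_const ((1:ℝ) / 25)
    have hpi : HasFDerivAt Φ (Φ' z) z := by
      rw [hasFDerivAt_pi']
      intro i
      fin_cases i
      · refine (hu.congr_fderiv ?_).congr_of_eventuallyEq (Filter.Eventually.of_forall fun y => ?_)
        · ext w
          simp [hΦ'ap, M00, M01]
          ring
        · simp only [Fin.zero_eta, hΦ0, Pi.add_apply, Pi.mul_apply, Pi.sub_apply, Pi.pow_apply, smul_eq_mul,
            Function.comp_apply]
          ring
      · refine (hB.congr_fderiv ?_).congr_of_eventuallyEq (Filter.Eventually.of_forall fun y => ?_)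
        · ext w
          simp [hΦ'ap]
        · simp only [Fin.mk_one, hΦ1]
    exact hpi.hasFDerivWithinAt
  · intro z₁ hz₁ z₂ hz₂ heq
    obtain ⟨a0, a1, aT, aDx, aD, -, -⟩ := FP1_facts z₁ hz₁
    obtain ⟨b0, b1, bT, bDx, bD, -, -⟩ := FP1_facts z₂ hz₂
    have e1 : z₁ 1 = z₂ 1 := by simpa [Φ] using congrFun heq 1
    have e0 : (16 * (1 - (1 + 2 * z₁ 1) * z₁ 0 + (2 + 2 * z₁ 1) * z₁ 0 * z₁ 0) - 7) / 25 =
        (16 * (1 - (1 + 2 * z₂ 1) * z₂ 0 + (2 + 2 * z₂ 1) * z₂ 0 * z₂ 0) - 7) / 25 := by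
      simpa [Φ] using congrFun heq 0
    rw [← e1] at e0 bDx
    have f0 : (z₁ 0 - z₂ 0) * ((2 + 2 * z₁ 1) * (z₁ 0 + z₂ 0) - (1 + 2 * z₁ 1)) = 0 := by
      linear_combination (25 / 16) * e0
    have s0 : z₁ 0 = z₂ 0 := by
      rcases mul_eq_zero.mp f0 with h | h
      · linarith
      · have hp : (0:ℝ) < 2 + 2 * z₁ 1 := by linarith
        have c1 : 0 ≤ (2 + 2 * z₁ 1) * (z₂ 0 - z₁ 0) := by linarith
        have c2 : 0 ≤ (2 + 2 * z₁ 1) * (z₁ 0 - z₂ 0) := by linarith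
        have d1 := (mul_nonneg_iff_of_pos_left hp).mp c1
        have d2 := (mul_nonneg_iff_of_pos_left hp).mp c2
        linarith
    funext i
    fin_cases i
    · exact s0
    · exact e1
  · intro z hz
    obtain ⟨h0, h1, ht, hDx, hD, hD1, hD7⟩ := FP1_facts z hz
    have hd : (Φ' z).det = 16 / 25 * ((4 + 4 * z 1) * z 0 - (1 + 2 * z 1)) := hdet z
    rw [hd, abs_of_nonpos (mul_nonpos_of_nonneg_of_nonpos (by norm_num) hDx)]
    simp only [M2log1, FN1, KZ.IntegralRep.integrand_restrict, RFun.rep_integrand]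
    simp only [M2log, FN, FTDen, M2LDen, M2Den, RFun.fn, Φ, map_add, map_sub, map_mul, map_neg, aeval_C, aeval_X,
      eq_ratCast, Rat.cast_one, Rat.cast_ofNat, Rat.cast_div, Rat.cast_neg, vec2_0, vec2_1, Matrix.cons_val_zero,
      Matrix.cons_val_one, Matrix.head_cons]
    have h2 : (2:ℝ) + 2 * z 1 ≠ 0 := by linarith
    rw [show (25:ℝ) * ((16 * (1 - (1 + 2 * z 1) * z 0 + (2 + 2 * z 1) * z 0 * z 0) - 7) / 25) + 7 =
        16 * (1 - (1 + 2 * z 1) * z 0 + (2 + 2 * z 1) * z 0 * z 0) by ring]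
    generalize hDv : 1 - (1 + 2 * z 1) * z 0 + (2 + 2 * z 1) * z 0 * z 0 = D at *
    have hD0 : D ≠ 0 := hD.ne'
    field_simp

/-- **THE FOLD**: `[M2log] − [Lhalf] ∈ KZ.relations` (`½log²2 = ½log²2`, by an orientation-cancelling
change of variables instead of the (non-semialgebraic) primitive `log M2Den`). -/
theorem M2log_half : KZ.of M2log.rep - KZ.of Lhalf.rep ∈ KZ.relations := by
  have e : KZ.of M2log.rep - KZ.of Lhalf.rep =
      (KZ.of M2log.rep - KZ.of M2log1 - KZ.of M2log2) + (KZ.of M2log2 - KZ.of FT2) + (KZ.of M2log1 - KZ.of FN1)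
        + (KZ.of FT2 - KZ.of FT1 - KZ.of FTB) + (KZ.of FT1 + KZ.of FN1) - (KZ.of Lhalf.rep - KZ.of FTB) := by
    abel
  rw [e]
  exact sub_mem (add_mem (add_mem (add_mem (add_mem M2log_add fold2_cov) fold1_cov) FT2_add) fold_cancel)
    Lhalf_FTB

/-! ### §19b  Coefficient-one log relations (the torsion audit of NODE §9.17): `[NL] ≡ 2•[MT]`,
`[N7U] ≡ 3•[MT] + 3•[Lhalf]` by affine dissections. -/

/-- a diagonal affine change of variables `(x,y) ↦ (a + b·x, c + d·y)` with rational coefficients. -/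
theorem rel_affine2 (r r' : KZ.IntegralRep 2) (a b c d : ℚ) (hb : b ≠ 0) (hd : d ≠ 0)
    (hdom : r'.domain = (fun z : Fin 2 → ℝ => (![(a:ℝ) + b * z 0, (c:ℝ) + d * z 1] : Fin 2 → ℝ)) '' r.domain)
    (hint : ∀ z ∈ r.domain, r.integrand z = r'.integrand ![(a:ℝ) + b * z 0, (c:ℝ) + d * z 1] * |(b:ℝ) * d|) :
    KZ.of r - KZ.of r' ∈ KZ.relations := by
  let Φ : (Fin 2 → ℝ) → (Fin 2 → ℝ) := fun z => ![(a:ℝ) + b * z 0, (c:ℝ) + d * z 1]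
  let Mz : Matrix (Fin 2) (Fin 2) ℝ := !![(b:ℝ), 0; 0, (d:ℝ)]
  let Φ' : (Fin 2 → ℝ) → (Fin 2 → ℝ) →L[ℝ] (Fin 2 → ℝ) := fun _ =>
    LinearMap.toContinuousLinearMap (Matrix.toLin' Mz)
  have hΦ'ap : ∀ z w, Φ' z w = ![(b:ℝ) * w 0, (d:ℝ) * w 1] := by
    intro z w; funext i
    fin_cases i <;> simp [Φ', Mz, Matrix.toLin'_apply, Matrix.mulVec, dotProduct, Fin.sum_univ_two]
  have hdet : ∀ z, (Φ' z).det = (b:ℝ) * d := by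
    intro z
    unfold ContinuousLinearMap.det
    simp [Φ', LinearMap.det_toLin', Mz, Matrix.det_fin_two]
  refine KZ.changeOfVariablesRel_subset_relations ⟨2, r, r', Φ, Φ', ?_, ?_, ?_, hdom, ?_, rfl⟩
  · have hsd : IsSemialgebraic ℚ r.domain := r.isSemialgebraic_domain
    refine (isSemialgebraicMapOn_iff_forall_holds hsd).mpr fun i => ?_
    fin_cases i
    · exact (isSemialgebraicFunOn_aeval hsd (C a + C b * X 0)).congr fun z _ => by simp [Φ]
    · exact (isSemialgebraicFunOn_aeval hsd (C c + C d * X 1)).congr fun z _ => by simp [Φ]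
  · intro z _
    have h0 := ((hasFDerivAt_apply (𝕜 := ℝ) 0 z).const_mul (b:ℝ)).const_add (a:ℝ)
    have h1 := ((hasFDerivAt_apply (𝕜 := ℝ) 1 z).const_mul (d:ℝ)).const_add (c:ℝ)
    have hpi : HasFDerivAt Φ (Φ' z) z := by
      rw [hasFDerivAt_pi']
      intro i
      fin_cases i
      · refine (h0.congr_fderiv ?_).congr_of_eventuallyEq (Filter.Eventually.of_forall fun y => ?_)
        · ext w
          simp [hΦ'ap]
        · simp [Φ]
      · refine (h1.congr_fderiv ?_).congr_of_eventuallyEq (Filter.Eventually.of_forall fun y => ?_)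
        · ext w
          simp [hΦ'ap]
        · simp [Φ]
    exact hpi.hasFDerivWithinAt
  · intro z₁ _ z₂ _ heq
    have hb' : (b:ℝ) ≠ 0 := by exact_mod_cast hb
    have hd' : (d:ℝ) ≠ 0 := by exact_mod_cast hd
    have e0 : (a:ℝ) + b * z₁ 0 = a + b * z₂ 0 := congrFun heq 0
    have e1 : (c:ℝ) + d * z₁ 1 = c + d * z₂ 1 := congrFun heq 1
    funext i
    fin_cases i
    · exact mul_left_cancel₀ hb' (add_left_cancel e0)
    · exact mul_left_cancel₀ hd' (add_left_cancel e1)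
  · intro z hz
    rw [hdet z]
    exact hint z hz

/-- `Nh := [□², ½/((2−x)(2−y))]` (half of `N`), `NhL := Nh | TriL`. -/
def Nh : RFun 2 := ⟨C (1 / 2), NDen, fun _ hx => (NDen_pos hx).ne'⟩
/-- Auxiliary definition `NhL` (§19b): Nh L. [bookkeeping] -/
def NhL : KZ.IntegralRep 2 := Nh.rep.restrict TriL isSemialgebraic_TriL (fun _ hz => hz.1)

/-- Auxiliary step `NL_twice` (§19b): NL twice. [bookkeeping] -/
theorem NL_twice : KZ.of NL - 2 • KZ.of NhL ∈ KZ.relations := by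
  have h : KZ.of NL - KZ.of NhL - KZ.of NhL ∈ KZ.relations := by
    refine KZ.integrandAddRel_subset_relations ⟨2, NL, NhL, NhL, rfl, rfl, fun x hx => ?_, rfl⟩
    have hx' : x ∈ cube 2 := hx.1
    obtain ⟨h0, h1⟩ := cube2 hx'
    simp only [NL, NhL, KZ.IntegralRep.integrand_restrict, RFun.rep_integrand, Pi.add_apply]
    simp only [N, Nh, NDen, RFun.fn, map_add, map_sub, map_mul, aeval_C, aeval_X, eq_ratCast, Rat.cast_one,
      Rat.cast_ofNat, Rat.cast_div]
    ring
  have e : KZ.of NL - 2 • KZ.of NhL = KZ.of NL - KZ.of NhL - KZ.of NhL := by rw [two_nsmul]; abel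
  rw [e]; exact h

/-- `[MT] ≡ [Nh | TriL]` by `(w,t) ↦ (1−2w, 1−t)`. -/
theorem MT_NhL : KZ.of MT - KZ.of NhL ∈ KZ.relations := by
  refine rel_affine2 MT NhL 1 (-2) 1 (-1) (by norm_num) (by norm_num) ?_ fun z hz => ?_
  · simp only [MT, NhL, KZ.IntegralRep.domain_restrict, RFun.rep_domain, Tri, TriL]
    ext w
    constructor
    · rintro ⟨hw, hL⟩
      simp only [mem_setOf_eq] at hL
      obtain ⟨hw0, hw1⟩ := cube2 hw
      refine ⟨![(1 - w 0) / 2, 1 - w 1], ⟨?_, ?_⟩, ?_⟩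
      · intro i
        fin_cases i
        · simp only [Fin.zero_eta, Matrix.cons_val_zero]
          constructor
          · apply div_nonneg _ (by norm_num); linarith
          · rw [div_le_one (by norm_num)]; linarith
        · simp only [Fin.mk_one, Matrix.cons_val_one, Matrix.head_cons, Matrix.cons_val_zero,
            Matrix.cons_val_fin_one]
          constructor <;> linarith
      · simp only [mem_setOf_eq, Matrix.cons_val_zero, Matrix.cons_val_one, Matrix.head_cons]
        linarith
      · funext i
        fin_cases i
        · simp; ring
        · simp
    · rintro ⟨z, ⟨hz, hT⟩, rfl⟩
      simp only [mem_setOf_eq] at hT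
      obtain ⟨h0, h1⟩ := cube2 hz
      refine ⟨fun i => ?_, ?_⟩
      · fin_cases i
        · simp only [Fin.zero_eta, Matrix.cons_val_zero, Rat.cast_one, Rat.cast_neg, Rat.cast_ofNat]
          constructor <;> linarith
        · simp only [Fin.mk_one, Matrix.cons_val_one, Matrix.head_cons, Matrix.cons_val_zero,
            Matrix.cons_val_fin_one, Rat.cast_one, Rat.cast_neg, Rat.cast_ofNat]
          constructor <;> linarith
      · simp only [mem_setOf_eq, Matrix.cons_val_zero, Matrix.cons_val_one, Matrix.head_cons, Rat.cast_one,
          Rat.cast_neg, Rat.cast_ofNat]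
        linarith
  · have hz' : z ∈ cube 2 := hz.1
    obtain ⟨h0, h1⟩ := cube2 hz'
    simp only [MT, NhL, KZ.IntegralRep.integrand_restrict, RFun.rep_integrand]
    simp only [Mst, Nh, MstDen, NDen, RFun.fn, map_add, map_sub, map_mul, aeval_C, aeval_X, eq_ratCast,
      Rat.cast_one, Rat.cast_ofNat, Rat.cast_div, Rat.cast_neg, vec2_0, vec2_1, Matrix.cons_val_zero,
      Matrix.cons_val_one, Matrix.head_cons]
    rw [show |(-2:ℝ) * -1| = 2 by norm_num]
    have ha : (1:ℝ) + z 1 ≠ 0 := by linarith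
    have hb : (1:ℝ) + 2 * z 0 ≠ 0 := by linarith
    rw [show (2:ℝ) - (1 + -2 * z 0) = 1 + 2 * z 0 by ring, show (2:ℝ) - (1 + -1 * z 1) = 1 + z 1 by ring]
    field_simp

/-- **`[NL] ≡ 2•[MT]`** (a weight-one log triangle is two weight-½ ones). -/
theorem NL_MT : KZ.of NL - 2 • KZ.of MT ∈ KZ.relations := by
  have e : KZ.of NL - 2 • KZ.of MT = (KZ.of NL - 2 • KZ.of NhL) - 2 • (KZ.of MT - KZ.of NhL) := by
    simp only [smul_sub]; abel
  rw [e]; exact sub_mem NL_twice (KZ.relations.nsmul_mem MT_NhL 2)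

end Fold
end Summit.KontsevichZagierPeriods.RootDecompQuadraticDescent.Pair18Homotopy
end
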